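import Literature.Barriers.RiemannHypothesis.TuranPartialSumsShiftLowBlocks

/-!
# Sections of `ζ` beyond `σ = 1`: the vertical-shift construction below `N = 360000` — certified run, chunk 2

One compiled evaluation (`native_decide`) of
`Literature.Barriers.RiemannHypothesis.TuranShift.LowCert.checkBlks 271440 blocks2`; see
`TuranPartialSumsShiftLowCheck.lean` for the checker, `TuranPartialSumsShiftLowBlocks.lean` for the
blocks and `TuranPartialSumsShiftLowSound.lean` (`exists_zero_of_checkBlks`) for its meaning: for
every `N` in one of these blocks (`157609 ≤ N ≤ 271440`), `ζ_N` vanishes somewhere in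
`σ > 1`. The only non-standard axiom of this file is the `native_decide` auxiliary axiom of
`blocks2_ok` (trust in the Lean compiler), declared to the gate as `computational`.
-/

namespace Literature.Barriers.RiemannHypothesis.TuranShift.LowCert

/-- **Chunk 2 of the blocks is accepted by the checker.** [folklore] -/
theorem blocks2_ok : checkBlks 271440 blocks2 = true := by
  native_decide

end Literature.Barriers.RiemannHypothesis.TuranShift.LowCert
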